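/-
Copyright (c) 2026 the pub-hodgecm-mathlib formalisation cell (harness21).  Prover seat hodgecm-mathlib-LH4-p07 (g9), req620 Track A «(D-RAM) FOUR-FRAME» squad
(STAGE-1b, row-(2) lineage; dealer LH4-plan (g13) WORD #58 RULING A ∕ #69 (4) ∕ #71 (4) ∕ #75 (1): owner of the two-literal census law of `lev_{a,m}`), 2026-09-04.
-/
import Summits.HodgeConjecture.HodgeConjecture.Theorems.F0P3cDyRamOrderCountCensusRamK            -- ★ socket (B) (LH4-p07 (g7) …): every organ of the unit road's bottom socket, by import
import Summits.HodgeConjecture.HodgeConjecture.Theorems.F0P3cDyRamLevelsCensusCutoffCM           -- ★ p860083 (this seat): (C2-lev-cutoff-CM) §1∕§2 over ★ p859485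
import Summits.HodgeConjecture.HodgeConjecture.Theorems.F0P3cDyRamLevelOrderCountsRamKWeldCut    -- ★ p860034 (this seat): (OC-weldΔ)-RamK, both lanes
import Summits.HodgeConjecture.HodgeConjecture.Theorems.F0P3cDyRamLevelsCensusLawArithRamK       -- ★ p859957 (this seat): `law_arith`, `sum_pow_add_eq_mul_sum`; brings `filter_band_eq_Ioc`
import Summits.HodgeConjecture.HodgeConjecture.Theorems.F0P3cDyRamLevelsSocketPrelude            -- ★ p860127 (this seat): `levels_bottom_arith` + token letters
import Summits.HodgeConjecture.HodgeConjecture.Theorems.F0P3cDyRamLevelsLawExponents              -- ★ p860331 (this seat): `exponents_std`, `exponents_flip`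
import Summits.HodgeConjecture.HodgeConjecture.Theorems.F0P3cDyRamLevelsSocketTokens              -- ★ p860370 (this seat): `levelTokens_near_one`
import Summits.HodgeConjecture.HodgeConjecture.Theorems.F0P3cDyRamConeWeightHalfSplitMultiplier  -- ★ p859752 (F0P3-p01 (g35)): (β′) `finsum_levelSetDep_weight_eq_pow_mul_ncard_inv_mul`, `levelSetDep_subset_of_eq_mul`
import Summits.HodgeConjecture.HodgeConjecture.Theorems.F0P3cDyRamConeWeightHalfSplit            -- ★ p857697: `exists_flipUnit_of_forall_fixed_fixed_isNorm`
import Literature.NumberTheory.Rogawski1990.UnitaryVertexStabilizerCoverCM                        -- ★ `placeForm_map_transpose_of_hermitian`, `galAdicCompletionMap_involutive`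
import Literature.NumberTheory.Rogawski1990.FinExplicitTransferFactorDeepTauUniform               -- ★ `eventually_nhds_one_valued_sub_one_le`
import HarnessLib

/-!
# Crux `H413`, line LH4 «(D-RAM) FOUR-FRAME» — STAGE-1b, row (2): SOCKET (B)-lev «THE TWO-LITERAL CENSUS LAW OF A LEVEL PIECE, TYPE RamK, AT THE CM PLACE»
Cell `hodgecm-mathlib` (D-0151), FLOOR 0, crux H413 = `stmt-HodgeConjecture-24833`, route `HCCMUnconditional`; squad F0∕P3c∕LH4; lane `--supports stmt-HodgeConjecture-24833 --as helper`
(count-neutral; pays NO tier-0 row).  THEOREMS ONLY.  OWNER'S ORGAN №12 = the RamK-lane BOTTOM SOCKET of the END `levels_typeTwo_censusLaw (a b) (cA cB)` (★ p859606's `hLaw`;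
dealer WORD #58 RULING A; SIG `SIG-levelsCensusB.skel.v2…` 8a298c40; upper ∃V assembly = LH4-p06 (g7), WORD #82 (A)).
STATEMENT = ★ `orderCountCensusB`'s binder list BYTE-VERBATIM + the piece `(a b ks T : ℕ)` under `a ≤ d`, `d + 2a ≤ b + 1` and LAW-INSTANCES v1's GENERAL RULE (`hks`, `hT0`, `hT1`;
rows of record sq ∕ lev_lo ∕ lev_hi ∕ T₊-lo ∕ T₊-hi); conclusion (i) = (B)'s, (ii) `(q − 1)·q^{ks}·(cnt_{a,b}(ι t_h) − cnt_{a,b}(ι t_a)) = (β,θ)_v·q^m·((q − 1)(#Fix + d%2) + 2 − 2q^T)`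
with ★ p859606's `hLaw` census sets VERBATIM.  PROOF = (B)'s skeleton (V ∩= the near-1 letters ★ p858075 ∕ ★ `eventually_nhds_one_valued_trace_sub_two_le` ∕ ★
`eventually_nhds_one_valued_sub_one_le`; frame ★ `ramK_frame_at_place'`; tokens, side symbol, anisotropy, H-side Eisenstein closed form EXACTLY as (B)) + the level block:
★ `levelTokens_near_one` → ★ p860083 §1∕§2 → (β′) ★ p859752 with ★ `exists_flipUnit…` (cutoff `j + b′ ≤ C := m + jλ − b`) → cells ⊆ unit cells (★ `levelSetDep_subset_of_eq_mul` ∘ ★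
`hRcells_h∕h′`) → ★ p860034 (lane by `a % 2`) → ★ `exponents_std∕flip` + ★ p859957 `law_arith` → ★ p860127 `levels_bottom_arith`.
HONEST LABEL.  Count-neutral; RamK lane only; `HC_CM` is proved only modulo the 7 printed citations (2 remaining named inputs: hLiu418 = `stmt-HodgeConjecture-24832`, h413 =
`stmt-HodgeConjecture-24833`) until rung 0 closes.
## References
* [Rogawski1990] J. D. Rogawski, *Automorphic Representations of Unitary Groups in Three Variables*, Ann. of Math. Stud. 123 (1990): §4.9 Prop. 4.9.1 (b) p. 55, Lemma 4.9.3 p. 56; §12.2.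
* [Kottwitz1986BaseChangeUnits] R. E. Kottwitz, *Base change for unit elements of Hecke algebras*, Compositio Math. 60 (1986): §1 pp. 240–241.
* [LabesseLanglands1979] J.-P. Labesse, R. P. Langlands, *L-indistinguishability for SL(2)*, Canad. J. Math. 31 (1979): §2 pp. 7–8.
* [Serre1979] J.-P. Serre, *Local Fields*, GTM 67 (1979): Ch. II §1; Ch. V §3 Prop. 5, Cor. 3.
-/

set_option autoImplicit false

noncomputable section

namespace Summit.HodgeConjecture.HodgeConjecture.Cruxes.H413.F0P3cDyRamLevelsCensusRamK

open MeasureTheory Measure NumberField IsDedekindDomain Topology Filter Literature.NumberTheory.Automorphic Literature.NumberTheory.Automorphic.UnitaryGroup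
open Literature.NumberTheory.Automorphic.IntegralReduction Literature.NumberTheory.Rogawski1990 Literature.NumberTheory.GaloisRepresentations
open Literature.NumberTheory.Automorphic.UnitaryThreeFourFrame Literature.NumberTheory.Automorphic.UnitaryLatticeTree Literature.NumberTheory.Automorphic.HermitianLattice
open Literature.NumberTheory.QuadraticForms Summit.HodgeConjecture.HodgeConjecture.Cruxes.H413.F0P3cDyRamToricCensusDefs
open Summit.HodgeConjecture.HodgeConjecture.Cruxes.H413.F0P3cDyRamToricLevelCensusRamKAtThirdField Summit.HodgeConjecture.HodgeConjecture.Cruxes.H413.F0P3cDyRamTypeTwoAnisotropyOfFrame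
open Summit.HodgeConjecture.HodgeConjecture.Cruxes.H413.F0P3cDyRamLevelsSocketPrelude Summit.HodgeConjecture.HodgeConjecture.Cruxes.H413.F0P3cDyRamLevelsCensusCutoffCM
open Summit.HodgeConjecture.HodgeConjecture.Cruxes.H413.F0P3cDyRamLevelOrderCountsRamKWeldCut Summit.HodgeConjecture.HodgeConjecture.Cruxes.H413.F0P3cDyRamToricCensusSumRamKCut
open Summit.HodgeConjecture.HodgeConjecture.Cruxes.H413.F0P3cDyRamLevelsCensusLawArithRamK Summit.HodgeConjecture.HodgeConjecture.Cruxes.H413.F0P3cDyRamLevelsLawExponents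
open Summit.HodgeConjecture.HodgeConjecture.Cruxes.H413.F0P3cDyRamLevelsSocketTokens Summit.HodgeConjecture.HodgeConjecture.Cruxes.H413.F0P3cDyRamConeWeightHalfSplitMultiplier
open Summit.HodgeConjecture.HodgeConjecture.Cruxes.H413.F0P3cDyRamConeWeightHalfSplit Summit.HodgeConjecture.HodgeConjecture.Cruxes.H413.F0P3cDyRamToricLevelCensusUnr
open Summit.HodgeConjecture.HodgeConjecture.Cruxes.H413.F0P3cDyRamToricLevelCensusRamK
open scoped Matrix MatrixGroups Classical Valued
open Summit.HodgeConjecture.HodgeConjecture.Cruxes.H413.F0P3cDyRamFourFrameCensusDefs (LatticeInLevel)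
open Summit.HodgeConjecture.HodgeConjecture.Cruxes.H413.F0P3cDyRamFrameRamKAtPlace (ramK_frame_at_place')
open Summit.HodgeConjecture.HodgeConjecture.Cruxes.H413.F0P3cDyRamTokenDepthNearOne (exists_nhds_one_le_tokenDepth eventually_nhds_one_le_tokenDepth)
open Summit.HodgeConjecture.HodgeConjecture.Cruxes.H413.F0P3cDyRamOrderFiltrationRange (isOrd_pow_iff_le)
open Summit.HodgeConjecture.HodgeConjecture.Cruxes.H413.F0P3cDyRamTypeUBottomFacts (mul_map_eq_one_of_mem_unitary_one map_fixed_and_mul_map_eq_one)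
open Summit.HodgeConjecture.HodgeConjecture.Cruxes.H413.F0P3cDyRamTokenFrameGlueRamK (v_eq_exp_neg_of_v_mul_map_eq)
open Summit.HodgeConjecture.HodgeConjecture.Cruxes.H413.F0P3cDyRamOrderCountCensusRamKNormaliser (btop_tokens_cm)
open Summit.HodgeConjecture.HodgeConjecture.Cruxes.H413.F0P3cDyRamOrderCountCensusRamKSymbol (btop_side_symbol_cm)
open Summit.HodgeConjecture.HodgeConjecture.Cruxes.H413.F0P3cDyRamHSideClosedForm (hSide_closedForm_of_tube_exists)
open Summit.HodgeConjecture.HodgeConjecture.Cruxes.H413.F0P3cDyRamHSideLevelLetter (valued_trace_eq_of_sub_two_lt)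
open Summit.HodgeConjecture.HodgeConjecture.Cruxes.H413.F0P3cDyRamTypeTwoLevelDictionary (sq_sub_map_eq_map_disc condLevel_eq_of_hlev)

set_option maxHeartbeats 4000000 in
-- budget only: the statement alone is ≈ 24 000 normalised characters of binders (socket (B)'s + the two level censuses); the proof is a composition of ★ organs (no search).
/-- **SOCKET (B)-lev — THE TWO-LITERAL CENSUS LAW OF THE LEVEL PIECE `lev(a, b)` ON TYPE RamK** (★ socket (B)'s binders verbatim + the piece `(a b ks T)` with its exponent rule):
near `1 ∈ H_v`, for every admissible `γ_H`, every RamK frame and literal data, (i) doubly fixed units are `Θ`-norms and (ii)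
`(q − 1)·q^{ks}·(cnt_{a,b}(ι t_h) − cnt_{a,b}(ι t_a)) = (β, θ)_v·q^m·((q − 1)(#Fix_{γ₂}(U₂⧸K_H) + d % 2) + 2 − 2q^T)`.  Composition over the ★ organs listed in the module docstring.
[cite: Rogawski1990, §4.9 Prop. 4.9.1 (b) p. 55, Lemma 4.9.3 p. 56] [cite: Kottwitz1986BaseChangeUnits, §1 pp. 240–241] [cite: LabesseLanglands1979, §2 pp. 7–8] [cite: Serre1979, Ch. V §3 Prop. 5, Cor. 3] -/
theorem levelsCensusB (L : Type) [Field L] [NumberField L] [IsCMField L]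
    {v : HeightOneSpectrum (𝓞 ↥(maximalRealSubfield L))} (w : UnitaryGroup.PlacesOver L v) (hw : IsCMField.complexConj L • w.1 = w.1) (he : v.asIdeal.ramificationIdx' w.1.asIdeal ≠ 1) (ϖ : (w.1.adicCompletion L)) (hϖ : Valued.v ϖ = WithZero.exp (-1 : ℤ)) (d tE : ℕ)
    (hD : IsRamifiedQuadraticDatum (galAdicCompletionMap (L := L) (IsCMField.complexConj L) hw) ϖ d tE) (h2v : Valued.v (2 : (w.1.adicCompletion L)) < 1) [Fintype (Valued.ResidueField (w.1.adicCompletion L))] (a b ks T : ℕ) (had : a ≤ d) (hab1 : d + 2 * a ≤ b + 1) (hks : 2 * ks + 2 * ((d + a % 2) / 2) = a + a % 2 + (b + b % 2))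
    (hT0 : a % 2 = 0 → T + a = ks + (d - d % 2)) (hT1 : a % 2 = 1 → T + a + 1 = ks + (d - d % 2) + 2 * (d % 2)) :
      ∃ V ∈ 𝓝 (1 : ((UnitaryGroup.cmDatum L 2 (Matrix.of fun i j : Fin 2 => if i.val + j.val + 1 = 2 then (1 : L) else 0)).Local v × (UnitaryGroup.cmDatum L 1 (Matrix.of fun i j : Fin 1 => if i.val + j.val + 1 = 1 then (1 : L) else 0)).Local v)), ∀ γH ∈ V, IsLocalGRegular L v γH →
        ¬ (∃ x : (w.1.adicCompletion L), (((((γH).1.val : GL (Fin 2) (UnitaryGroup.LocalRing L v)).val.map (Pi.evalRingHom (fun w' : UnitaryGroup.PlacesOver L v => w'.1.adicCompletion L) w))).charpoly).IsRoot x) →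
        ∀ (E' : Type) [Field E'] [NumberField E'] [Algebra L E'] [Algebra.IsQuadraticExtension L E'] (c₁ : E' ≃ₐ[L] E') (δ : E') (m₀ : L) (s : (w.1.adicCompletion L)) (w₁ : UnitaryGroup.PlacesOver E' w.1) (hw₁ : c₁ • w₁.1 = w₁.1) (Θ : (w₁.1.adicCompletion E') →+* (w₁.1.adicCompletion E')) (α lam : (w₁.1.adicCompletion E')),
          c₁ ≠ 1 → c₁ δ = -δ → δ ≠ 0 → algebraMap L E' m₀ = δ ^ 2 → s ≠ 0 →
          (((γH.1.val : GL (Fin 2) (UnitaryGroup.LocalRing L v)).val.map (Pi.evalRingHom (fun w' : UnitaryGroup.PlacesOver L v => w'.1.adicCompletion L) w))).trace * (((γH.1.val : GL (Fin 2) (UnitaryGroup.LocalRing L v)).val.map (Pi.evalRingHom (fun w' : UnitaryGroup.PlacesOver L v => w'.1.adicCompletion L) w))).trace - 4 * (((γH.1.val : GL (Fin 2) (UnitaryGroup.LocalRing L v)).val.map (Pi.evalRingHom (fun w' : UnitaryGroup.PlacesOver L v => w'.1.adicCompletion L) w))).det = s * s * ((m₀ : L) : (w.1.adicCompletion L)) 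→
          (((γH.1.val : GL (Fin 2) (UnitaryGroup.LocalRing L v)).val.map (Pi.evalRingHom (fun w' : UnitaryGroup.PlacesOver L v => w'.1.adicCompletion L) w))).det * (galAdicCompletionMap (L := L) (IsCMField.complexConj L) hw) (((γH.1.val : GL (Fin 2) (UnitaryGroup.LocalRing L v)).val.map (Pi.evalRingHom (fun w' : UnitaryGroup.PlacesOver L v => w'.1.adicCompletion L) w))).det = 1 → (((γH.1.val : GL (Fin 2) (UnitaryGroup.LocalRing L v)).val.map (Pi.evalRingHom (fun w' : UnitaryGroup.PlacesOver L v => w'.1.adicCompletion L) w))).trace = (((γH.1.val : GL (Fin 2) (UnitaryGroup.LocalRing L v)).val.map (Pi.evalRingHom (fun w' : UnitaryGroup.PlacesOver L v => w'.1.adicCompletion L) w))).det * (galAdicCompletionMap (L := L) (IsCMField.complexConj L) hw) (((γH.1.val : GL (Fin 2) (UnitaryGroup.LocalRing L v)).val.map (Pi.evalRingHom (fun w' : UnitaryGroup.PlacesOver L v => w'.1.adicCompletion L) w))).trace →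
          (∀ x : (w.1.adicCompletion L), x * x - (((γH.1.val : GL (Fin 2) (UnitaryGroup.LocalRing L v)).val.map (Pi.evalRingHom (fun w' : UnitaryGroup.PlacesOver L v => w'.1.adicCompletion L) w))).trace * x + (((γH.1.val : GL (Fin 2) (UnitaryGroup.LocalRing L v)).val.map (Pi.evalRingHom (fun w' : UnitaryGroup.PlacesOver L v => w'.1.adicCompletion L) w))).det ≠ 0) →
          (∀ z, galAdicCompletionMap (L := E') c₁ hw₁ (galAdicCompletionMap (L := E') c₁ hw₁ z) = z) → (∀ z, Valued.v (galAdicCompletionMap (L := E') c₁ hw₁ z) = Valued.v z) → (∀ a, galAdicCompletionMap (L := E') c₁ hw₁ (toPlace w.1 w₁ a) = toPlace w.1 w₁ a) → (∀ a, Valued.v (toPlace w.1 w₁ a) ≤ 1 ↔ Valued.v a ≤ 1) →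
          (∀ z : (w₁.1.adicCompletion E'), galAdicCompletionMap (L := E') c₁ hw₁ z = z ↔ ∃ a, toPlace w.1 w₁ a = z) → (∀ a, Θ (toPlace w.1 w₁ a) = toPlace w.1 w₁ ((galAdicCompletionMap (L := L) (IsCMField.complexConj L) hw) a)) → (∀ z, Θ (Θ z) = z) →
          (∀ z, Θ (galAdicCompletionMap (L := E') c₁ hw₁ z) = galAdicCompletionMap (L := E') c₁ hw₁ (Θ z)) → (∀ z, Valued.v (Θ z) = Valued.v z) → galAdicCompletionMap (L := E') c₁ hw₁ α ≠ α → Valued.v α ≤ 1 →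
          (∀ z : (w₁.1.adicCompletion E'), Valued.v z ≤ 1 → Valued.v ((z - galAdicCompletionMap (L := E') c₁ hw₁ z) / (α - galAdicCompletionMap (L := E') c₁ hw₁ α)) ≤ 1) →
          2 * lam = toPlace w.1 w₁ (((γH.1.val : GL (Fin 2) (UnitaryGroup.LocalRing L v)).val.map (Pi.evalRingHom (fun w' : UnitaryGroup.PlacesOver L v => w'.1.adicCompletion L) w))).trace + toPlace w.1 w₁ s * ((δ : E') : (w₁.1.adicCompletion E')) →
          lam * lam = toPlace w.1 w₁ (((γH.1.val : GL (Fin 2) (UnitaryGroup.LocalRing L v)).val.map (Pi.evalRingHom (fun w' : UnitaryGroup.PlacesOver L v => w'.1.adicCompletion L) w))).trace * lam - toPlace w.1 w₁ (((γH.1.val : GL (Fin 2) (UnitaryGroup.LocalRing L v)).val.map (Pi.evalRingHom (fun w' : UnitaryGroup.PlacesOver L v => w'.1.adicCompletion L) w))).det →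
          galAdicCompletionMap (L := E') c₁ hw₁ lam = toPlace w.1 w₁ (((γH.1.val : GL (Fin 2) (UnitaryGroup.LocalRing L v)).val.map (Pi.evalRingHom (fun w' : UnitaryGroup.PlacesOver L v => w'.1.adicCompletion L) w))).trace - lam → Θ lam * lam = 1 → Valued.v lam = 1 →
          (∀ z : (w₁.1.adicCompletion E'), ∃! pq : (w.1.adicCompletion L) × (w.1.adicCompletion L), z = toPlace w.1 w₁ pq.1 + toPlace w.1 w₁ pq.2 * lam) → Valued.v (α - (galAdicCompletionMap (L := E') c₁ hw₁) α) = 1 → Valued.v (α - Θ α) < 1 →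
          ∀ (th ta : ((UnitaryGroup.cmDatum L 3 (Matrix.of fun i j : Fin 3 => if i.val + j.val + 1 = 3 then (1 : L) else 0)).Local v)) (P₁ : GL (Fin 3) (w.1.adicCompletion L)) (dg : Fin 2 → (w.1.adicCompletion L)) (η : (w.1.adicCompletion L)) (γ₁ : GL (Fin 2) (w.1.adicCompletion L)),
            ((localNonsplitEquiv (IsCMField.complexConj L) (Matrix.of fun i j : Fin 3 => if i.val + j.val + 1 = 3 then (1 : L) else 0) (IsCMField.complexConj_ne_one L) w hw th : ↥(unitaryGroupOfForm (galAdicCompletionMap (L := L) (IsCMField.complexConj L) hw) (placeForm (Matrix.of fun i j : Fin 3 => if i.val + j.val + 1 = 3 then (1 : L) else 0) w.1))) : GL (Fin 3) (w.1.adicCompletion L)) = endoGL (((localNonsplitEquiv (IsCMField.complexConj L) (Matrix.of fun i j : Fin 2 => if i.val + j.val + 1 = 2 then (1 : L) else 0) (IsCMField.complexConj_ne_one L) w hw γH.1 : ↥(unitaryGroupOfForm (galAdicCompletionMap (L := L) (IsCMField.complexConj L) hw) (placeForm (Matrix.of fun i j : Fin 2 => if i.val + j.val + 1 = 2 then (1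 : L) else 0) w.1))) : GL (Fin 2) (w.1.adicCompletion L)), ((localNonsplitEquiv (IsCMField.complexConj L) (Matrix.of fun i j : Fin 1 => if i.val + j.val + 1 = 1 then (1 : L) else 0) (IsCMField.complexConj_ne_one L) w hw γH.2).val : GL (Fin 1) (w.1.adicCompletion L))) →
            ((localNonsplitEquiv (IsCMField.complexConj L) (Matrix.of fun i j : Fin 3 => if i.val + j.val + 1 = 3 then (1 : L) else 0) (IsCMField.complexConj_ne_one L) w hw ta : ↥(unitaryGroupOfForm (galAdicCompletionMap (L := L) (IsCMField.complexConj L) hw) (placeForm (Matrix.of fun i j : Fin 3 => if i.val + j.val + 1 = 3 then (1 : L) else 0) w.1))) : GL (Fin 3) (w.1.adicCompletion L)) = P₁ * endoGL (γ₁, ((localNonsplitEquiv (IsCMField.complexConj L) (Matrix.of fun i j : Fin 1 => if i.val + j.val + 1 = 1 then (1 : L) else 0) (IsCMField.complexConj_ne_one L) w hw γH.2).val : GL (Fin 1) (w.1.adicCompletion L))) * P₁⁻¹ →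
            formCongr (galAdicCompletionMap (L := L) (IsCMField.complexConj L) hw) P₁ (placeForm (Matrix.of fun i j : Fin 3 => if i.val + j.val + 1 = 3 then (1 : L) else 0) w.1) = (!![(Matrix.diagonal dg) 0 0, 0, (Matrix.diagonal dg) 0 1; 0, η, 0; (Matrix.diagonal dg) 1 0, 0, (Matrix.diagonal dg) 1 1] : Matrix (Fin 3) (Fin 3) (w.1.adicCompletion L)) →
            (∀ i, Valued.v (dg i) = 1) → (∀ i, (galAdicCompletionMap (L := L) (IsCMField.complexConj L) hw) (dg i) = dg i) → (galAdicCompletionMap (L := L) (IsCMField.complexConj L) hw) η = η → Valued.v η = 1 → (¬ ∃ t : (w.1.adicCompletion L), t * (galAdicCompletionMap (L := L) (IsCMField.complexConj L) hw) t = η) →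
            γ₁ ∈ unitaryGroupOfForm (galAdicCompletionMap (L := L) (IsCMField.complexConj L) hw) (Matrix.diagonal dg) →
            (γ₁ : Matrix (Fin 2) (Fin 2) (w.1.adicCompletion L)).charpoly = (((γH.1.val : GL (Fin 2) (UnitaryGroup.LocalRing L v)).val.map (Pi.evalRingHom (fun w' : UnitaryGroup.PlacesOver L v => w'.1.adicCompletion L) w))).charpoly →
          ∀ (φ : (Fin 2 → (w.1.adicCompletion L)) →+ (w₁.1.adicCompletion E')) (h : (w₁.1.adicCompletion E')) (φ' : (Fin 2 → (w.1.adicCompletion L)) →+ (w₁.1.adicCompletion E')) (h' : (w₁.1.adicCompletion E')),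
            (∀ (c : (w.1.adicCompletion L)) (x : Fin 2 → (w.1.adicCompletion L)), φ (c • x) = toPlace w.1 w₁ c * φ x) → Function.Injective φ → Function.Surjective φ →
            (∀ x, φ ((((localNonsplitEquiv (IsCMField.complexConj L) (Matrix.of fun i j : Fin 2 => if i.val + j.val + 1 = 2 then (1 : L) else 0) (IsCMField.complexConj_ne_one L) w hw γH.1 : ↥(unitaryGroupOfForm (galAdicCompletionMap (L := L) (IsCMField.complexConj L) hw) (placeForm (Matrix.of fun i j : Fin 2 => if i.val + j.val + 1 = 2 then (1 : L) else 0) w.1))) : GL (Fin 2) (w.1.adicCompletion L)) : Matrix (Fin 2) (Fin 2) (w.1.adicCompletion L)).mulVec x) = lam * φ x) →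
            (∀ x y, toPlace w.1 w₁ (pairing (galAdicCompletionMap (L := L) (IsCMField.complexConj L) hw) (placeForm (Matrix.of fun i j : Fin 2 => if i.val + j.val + 1 = 2 then (1 : L) else 0) w.1) x y) = h * Θ (φ x) * φ y + galAdicCompletionMap (L := E') c₁ hw₁ (h * Θ (φ x) * φ y)) → Θ h = h → h ≠ 0 →
            (∃ x : (w₁.1.adicCompletion E'), x ≠ 0 ∧ h * Θ x * x + galAdicCompletionMap (L := E') c₁ hw₁ (h * Θ x * x) = 0) → (∀ (c : (w.1.adicCompletion L)) (x : Fin 2 → (w.1.adicCompletion L)), φ' (c • x) = toPlace w.1 w₁ c * φ' x) → Function.Injective φ' → Function.Surjective φ' →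
            (∀ x, φ' ((γ₁ : Matrix (Fin 2) (Fin 2) (w.1.adicCompletion L)).mulVec x) = lam * φ' x) → (∀ x y, toPlace w.1 w₁ (pairing (galAdicCompletionMap (L := L) (IsCMField.complexConj L) hw) (Matrix.diagonal dg) x y) = h' * Θ (φ' x) * φ' y + galAdicCompletionMap (L := E') c₁ hw₁ (h' * Θ (φ' x) * φ' y)) → Θ h' = h' → h' ≠ 0 →
            (∀ (t : (w.1.adicCompletion L)) (n : ℤ), Valued.v (toPlace w.1 w₁ t) = Valued.v (toPlace w.1 w₁ ϖ) ^ n ↔ Valued.v t = Valued.v ϖ ^ n) → (∀ c : (w₁.1.adicCompletion E'), galAdicCompletionMap (L := E') c₁ hw₁ c = c → c ≠ 0 → Valued.v c ≤ 1 → ∃ n : ℕ, Valued.v c = Valued.v (toPlace w.1 w₁ ϖ) ^ n) →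
            (∀ t : (w₁.1.adicCompletion E'), galAdicCompletionMap (L := E') c₁ hw₁ t = t → Valued.v t < 1 → Valued.v t ≤ Valued.v (toPlace w.1 w₁ ϖ)) → ∀ (J R R' : ℕ) (f f' : ℕ → ℕ → AddSubgroup (w₁.1.adicCompletion E') → ℕ),
              {M₃ : Submodule (Valued.integer (w.1.adicCompletion L)) (Fin 3 → (w.1.adicCompletion L)) | IsVertexLattice (galAdicCompletionMap (L := L) (IsCMField.complexConj L) hw) ϖ ((StdForm.antidiagonal 3).over (w.1.adicCompletion L)) 0 M₃ ∧ mapGL (endoGL (((localNonsplitEquiv (IsCMField.complexConj L) (Matrix.of fun i j : Fin 2 => if i.val + j.val + 1 = 2 then (1 : L) else 0) (IsCMField.complexConj_ne_one L) w hw γH.1 : ↥(unitaryGroupOfForm (galAdicCompletionMap (L := L) (IsCMField.complexConj L) hw) (placeForm (Matrix.of fun i j : Fin 2 => if i.val + j.val + 1 = 2 then (1 : L) else 0) w.1))) : GL (Fin 2) (w.1.adicCompletion L)), ((localNonsplitEquiv (IsCMField.complexConj L) (Matrix.of fun i j : Fin 1 => if i.val + j.val + 1 = 1 then (1 : L) else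 0) (IsCMField.complexConj_ne_one L) w hw γH.2).val : GL (Fin 1) (w.1.adicCompletion L)))) M₃ = M₃}.Finite →
              (∀ M₃ : Submodule (Valued.integer (w.1.adicCompletion L)) (Fin 3 → (w.1.adicCompletion L)), IsVertexLattice (galAdicCompletionMap (L := L) (IsCMField.complexConj L) hw) ϖ ((StdForm.antidiagonal 3).over (w.1.adicCompletion L)) 0 M₃ → mapGL (endoGL (((localNonsplitEquiv (IsCMField.complexConj L) (Matrix.of fun i j : Fin 2 => if i.val + j.val + 1 = 2 then (1 : L) else 0) (IsCMField.complexConj_ne_one L) w hw γH.1 : ↥(unitaryGroupOfForm (galAdicCompletionMap (L := L) (IsCMField.complexConj L) hw) (placeForm (Matrix.of fun i j : Fin 2 => if i.val + j.val + 1 = 2 then (1 : L) else 0) w.1))) : GL (Fin 2) (w.1.adicCompletion L)), ((localNonsplitEquiv (IsCMField.complexConj L) (Matrix.of fun i j : Fin 1 => if i.val + j.val + 1 = 1 then (1 : L) else 0) (IsCMField.complexConj_ne_one L) w hw γH.2).val : GL (Fin 1) (w.1.adicCompletion L)))) M₃ = M₃ →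
                ∀ b : ℕ, (∀ c : (w.1.adicCompletion L), (Pi.single 1 c : Fin 3 → (w.1.adicCompletion L)) ∈ M₃ ↔ Valued.v c ≤ Valued.v ϖ ^ b) → b ≤ R) →
              {M₃ : Submodule (Valued.integer (w.1.adicCompletion L)) (Fin 3 → (w.1.adicCompletion L)) | IsSelfDualLattice (galAdicCompletionMap (L := L) (IsCMField.complexConj L) hw) ϖ (!![(Matrix.diagonal dg) 0 0, 0, (Matrix.diagonal dg) 0 1; 0, η, 0; (Matrix.diagonal dg) 1 0, 0, (Matrix.diagonal dg) 1 1] : Matrix (Fin 3) (Fin 3) (w.1.adicCompletion L)) M₃ ∧ mapGL (endoGL (γ₁, ((localNonsplitEquiv (IsCMField.complexConj L) (Matrix.of fun i j : Fin 1 => if i.val + j.val + 1 = 1 then (1 : L) else 0) (IsCMField.complexConj_ne_one L) w hw γH.2).val : GL (Fin 1) (w.1.adicCompletion L)))) M₃ = M₃}.Finite →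
              (∀ M₃ : Submodule (Valued.integer (w.1.adicCompletion L)) (Fin 3 → (w.1.adicCompletion L)), IsSelfDualLattice (galAdicCompletionMap (L := L) (IsCMField.complexConj L) hw) ϖ (!![(Matrix.diagonal dg) 0 0, 0, (Matrix.diagonal dg) 0 1; 0, η, 0; (Matrix.diagonal dg) 1 0, 0, (Matrix.diagonal dg) 1 1] : Matrix (Fin 3) (Fin 3) (w.1.adicCompletion L)) M₃ → mapGL (endoGL (γ₁, ((localNonsplitEquiv (IsCMField.complexConj L) (Matrix.of fun i j : Fin 1 => if i.val + j.val + 1 = 1 then (1 : L) else 0) (IsCMField.complexConj_ne_one L) w hw γH.2).val : GL (Fin 1) (w.1.adicCompletion L)))) M₃ = M₃ →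
                ∀ b : ℕ, (∀ c : (w.1.adicCompletion L), (Pi.single 1 c : Fin 3 → (w.1.adicCompletion L)) ∈ M₃ ↔ Valued.v c ≤ Valued.v ϖ ^ b) → b ≤ R') → ¬ IsOrd (galAdicCompletionMap (L := E') c₁ hw₁) α (toPlace w.1 w₁ ϖ ^ (J + 1)) lam →
              (∀ j a, (levelSet (galAdicCompletionMap (L := E') c₁ hw₁) Θ α (toPlace w.1 w₁ ϖ) h j a).Finite) → (∀ j a, (levelSet (galAdicCompletionMap (L := E') c₁ hw₁) Θ α (toPlace w.1 w₁ ϖ) h' j a).Finite) →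
              Valued.v ((((localNonsplitEquiv (IsCMField.complexConj L) (Matrix.of fun i j : Fin 1 => if i.val + j.val + 1 = 1 then (1 : L) else 0) (IsCMField.complexConj_ne_one L) w hw γH.2).val : GL (Fin 1) (w.1.adicCompletion L)) : Matrix (Fin 1) (Fin 1) (w.1.adicCompletion L)) 0 0) = 1 →
              (∀ (b j : ℕ) (Λ : AddSubgroup (w₁.1.adicCompletion E')) (x₀ : (w₁.1.adicCompletion E')) (r : (w.1.adicCompletion L)), 1 ≤ b → x₀ ≠ 0 → (∀ x, x ∈ Λ ↔ ∃ z, IsOrd (galAdicCompletionMap (L := E') c₁ hw₁) α (toPlace w.1 w₁ ϖ ^ j) z ∧ x = x₀ * z) →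
                IsOrd (galAdicCompletionMap (L := E') c₁ hw₁) α (toPlace w.1 w₁ ϖ ^ j) (dualGen (galAdicCompletionMap (L := E') c₁ hw₁) Θ α (toPlace w.1 w₁ ϖ ^ j) h x₀) → ¬ IsOrd (galAdicCompletionMap (L := E') c₁ hw₁) α (toPlace w.1 w₁ ϖ ^ j) (dualGen (galAdicCompletionMap (L := E') c₁ hw₁) Θ α (toPlace w.1 w₁ ϖ ^ j) h x₀ / toPlace w.1 w₁ ϖ) →
                Valued.v (dualGen (galAdicCompletionMap (L := E') c₁ hw₁) Θ α (toPlace w.1 w₁ ϖ ^ j) h x₀) = Valued.v (toPlace w.1 w₁ ϖ) ^ b →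
                (∀ b', (∀ x ∈ Λ, Valued.v (h * Θ x * b' + galAdicCompletionMap (L := E') c₁ hw₁ (h * Θ x * b')) ≤ 1) → (lam - toPlace w.1 w₁ ((((localNonsplitEquiv (IsCMField.complexConj L) (Matrix.of fun i j : Fin 1 => if i.val + j.val + 1 = 1 then (1 : L) else 0) (IsCMField.complexConj_ne_one L) w hw γH.2).val : GL (Fin 1) (w.1.adicCompletion L)) : Matrix (Fin 1) (Fin 1) (w.1.adicCompletion L)) 0 0)) * b' ∈ Λ) →
                IsOrd (galAdicCompletionMap (L := E') c₁ hw₁) α (toPlace w.1 w₁ ϖ ^ j) lam → toPlace w.1 w₁ r = glueUnit (galAdicCompletionMap (L := E') c₁ hw₁) Θ α (toPlace w.1 w₁ ϖ ^ j) h (toPlace w.1 w₁ ϖ) (toPlace w.1 w₁ 1) x₀ b →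
                f b j Λ = Nat.card {x : 𝒪[(w.1.adicCompletion L)] ⧸ 𝓂[(w.1.adicCompletion L)] ^ (2 * b) // ∃ u' : 𝒪[(w.1.adicCompletion L)], Ideal.Quotient.mk (𝓂[(w.1.adicCompletion L)] ^ (2 * b)) u' = x ∧
                  Valued.v ((u' : (w.1.adicCompletion L)) * (galAdicCompletionMap (L := L) (IsCMField.complexConj L) hw) u' - r) ≤ Valued.v (ϖ ^ (2 * b))}) → (∀ (b j : ℕ) (Λ : AddSubgroup (w₁.1.adicCompletion E')) (x₀ : (w₁.1.adicCompletion E')) (r : (w.1.adicCompletion L)), 1 ≤ b → x₀ ≠ 0 →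
                (∀ x, x ∈ Λ ↔ ∃ z, IsOrd (galAdicCompletionMap (L := E') c₁ hw₁) α (toPlace w.1 w₁ ϖ ^ j) z ∧ x = x₀ * z) →
                IsOrd (galAdicCompletionMap (L := E') c₁ hw₁) α (toPlace w.1 w₁ ϖ ^ j) (dualGen (galAdicCompletionMap (L := E') c₁ hw₁) Θ α (toPlace w.1 w₁ ϖ ^ j) h' x₀) → ¬ IsOrd (galAdicCompletionMap (L := E') c₁ hw₁) α (toPlace w.1 w₁ ϖ ^ j) (dualGen (galAdicCompletionMap (L := E') c₁ hw₁) Θ α (toPlace w.1 w₁ ϖ ^ j) h' x₀ / toPlace w.1 w₁ ϖ) →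
                Valued.v (dualGen (galAdicCompletionMap (L := E') c₁ hw₁) Θ α (toPlace w.1 w₁ ϖ ^ j) h' x₀) = Valued.v (toPlace w.1 w₁ ϖ) ^ b →
                (∀ b', (∀ x ∈ Λ, Valued.v (h' * Θ x * b' + galAdicCompletionMap (L := E') c₁ hw₁ (h' * Θ x * b')) ≤ 1) → (lam - toPlace w.1 w₁ ((((localNonsplitEquiv (IsCMField.complexConj L) (Matrix.of fun i j : Fin 1 => if i.val + j.val + 1 = 1 then (1 : L) else 0) (IsCMField.complexConj_ne_one L) w hw γH.2).val : GL (Fin 1) (w.1.adicCompletion L)) : Matrix (Fin 1) (Fin 1) (w.1.adicCompletion L)) 0 0)) * b' ∈ Λ) →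
                IsOrd (galAdicCompletionMap (L := E') c₁ hw₁) α (toPlace w.1 w₁ ϖ ^ j) lam → toPlace w.1 w₁ r = glueUnit (galAdicCompletionMap (L := E') c₁ hw₁) Θ α (toPlace w.1 w₁ ϖ ^ j) h' (toPlace w.1 w₁ ϖ) (toPlace w.1 w₁ η) x₀ b →
                f' b j Λ = Nat.card {x : 𝒪[(w.1.adicCompletion L)] ⧸ 𝓂[(w.1.adicCompletion L)] ^ (2 * b) // ∃ u' : 𝒪[(w.1.adicCompletion L)], Ideal.Quotient.mk (𝓂[(w.1.adicCompletion L)] ^ (2 * b)) u' = x ∧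
                  Valued.v ((u' : (w.1.adicCompletion L)) * (galAdicCompletionMap (L := L) (IsCMField.complexConj L) hw) u' - r) ≤ Valued.v (ϖ ^ (2 * b))}) → (∀ f₀ : (w₁.1.adicCompletion E'), galAdicCompletionMap (L := E') c₁ hw₁ f₀ = f₀ → Θ f₀ = f₀ → Valued.v f₀ = 1 → ∃ z : (w₁.1.adicCompletion E'), z * Θ z = f₀) ∧
            (∀ (m : ℕ) (β : (v.adicCompletion ↥(maximalRealSubfield L))ˣ), Valued.v (((finCharpolyTwo L v γH).eval (finGammaTwo L v γH)) w) = Valued.v ((toPlace v w (HeckeCharacter.uniformizer ↥(maximalRealSubfield L) v : v.adicCompletion ↥(maximalRealSubfield L))) ^ m) →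
              toPlace v w (β : (v.adicCompletion ↥(maximalRealSubfield L))) = -(((finCharpolyTwo L v γH).eval (finGammaTwo L v γH)) w * (finGammaTwo L v γH w ^ 2 + ((γH.1.val.val : Matrix (Fin 2) (Fin 2) (UnitaryGroup.LocalRing L v)).map (Pi.evalRingHom (fun w' : UnitaryGroup.PlacesOver L v => w'.1.adicCompletion L) w)).det)) / (2 * finGammaTwo L v γH w ^ 2 * ((γH.1.val.val : Matrix (Fin 2) (Fin 2) (UnitaryGroup.LocalRing L v)).map (Pi.evalRingHom (fun w' : UnitaryGroup.PlacesOver L v => w'.1.adicCompletion L) w)).det) →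
              (((Fintype.card (Valued.ResidueField (w.1.adicCompletion L))) : ℤ) - 1) * ((Fintype.card (Valued.ResidueField (w.1.adicCompletion L))) : ℤ) ^ ks * ((({M : Submodule (Valued.integer (w.1.adicCompletion L)) (Fin 3 → w.1.adicCompletion L) |
              IsVertexLattice (galAdicCompletionMap (L := L) (IsCMField.complexConj L) hw) ϖ ((StdForm.antidiagonal 3).over (w.1.adicCompletion L)) 0 M ∧
                mapGL ((localNonsplitEquiv (IsCMField.complexConj L) (Matrix.of fun i j : Fin 3 => if i.val + j.val + 1 = 3 then (1 : L) else 0) (IsCMField.complexConj_ne_one L) w hw th : ↥(unitaryGroupOfForm (galAdicCompletionMap (L := L) (IsCMField.complexConj L) hw) (placeForm (Matrix.of fun i j : Fin 3 => if i.val + j.val + 1 = 3 then (1 : L) else 0) w.1))) : GL (Fin 3) (w.1.adicCompletion L)) M = M ∧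
                (LatticeInLevel ϖ a ((((localNonsplitEquiv (IsCMField.complexConj L) (Matrix.of fun i j : Fin 3 => if i.val + j.val + 1 = 3 then (1 : L) else 0) (IsCMField.complexConj_ne_one L) w hw th : ↥(unitaryGroupOfForm (galAdicCompletionMap (L := L) (IsCMField.complexConj L) hw) (placeForm (Matrix.of fun i j : Fin 3 => if i.val + j.val + 1 = 3 then (1 : L) else 0) w.1))) : GL (Fin 3) (w.1.adicCompletion L)) : Matrix (Fin 3) (Fin 3) (w.1.adicCompletion L)) - 1) M ∧
                  LatticeInLevel ϖ b (((((localNonsplitEquiv (IsCMField.complexConj L) (Matrix.of fun i j : Fin 3 => if i.val + j.val + 1 = 3 then (1 : L) else 0) (IsCMField.complexConj_ne_one L) w hw th : ↥(unitaryGroupOfForm (galAdicCompletionMap (L := L) (IsCMField.complexConj L) hw) (placeForm (Matrix.of fun i j : Fin 3 => if i.val + j.val + 1 = 3 then (1 : L) else 0) w.1))) : GL (Fin 3) (w.1.adicCompletion L)) : Matrix (Fin 3) (Fin 3) (w.1.adicCompletion L)) - 1) *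
                    ((((localNonsplitEquiv (IsCMField.complexConj L) (Matrix.of fun i j : Fin 3 => if i.val + j.val + 1 = 3 then (1 : L) else 0) (IsCMField.complexConj_ne_one L) w hw th : ↥(unitaryGroupOfForm (galAdicCompletionMap (L := L) (IsCMField.complexConj L) hw) (placeForm (Matrix.of fun i j : Fin 3 => if i.val + j.val + 1 = 3 then (1 : L) else 0) w.1))) : GL (Fin 3) (w.1.adicCompletion L)) : Matrix (Fin 3) (Fin 3) (w.1.adicCompletion L)) - 1)) M)}.ncard : ℕ) : ℤ) -
                  (({M : Submodule (Valued.integer (w.1.adicCompletion L)) (Fin 3 → w.1.adicCompletion L) | IsVertexLattice (galAdicCompletionMap (L := L) (IsCMField.complexConj L) hw) ϖ ((StdForm.antidiagonal 3).over (w.1.adicCompletion L)) 0 M ∧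
                mapGL ((localNonsplitEquiv (IsCMField.complexConj L) (Matrix.of fun i j : Fin 3 => if i.val + j.val + 1 = 3 then (1 : L) else 0) (IsCMField.complexConj_ne_one L) w hw ta : ↥(unitaryGroupOfForm (galAdicCompletionMap (L := L) (IsCMField.complexConj L) hw) (placeForm (Matrix.of fun i j : Fin 3 => if i.val + j.val + 1 = 3 then (1 : L) else 0) w.1))) : GL (Fin 3) (w.1.adicCompletion L)) M = M ∧
                (LatticeInLevel ϖ a ((((localNonsplitEquiv (IsCMField.complexConj L) (Matrix.of fun i j : Fin 3 => if i.val + j.val + 1 = 3 then (1 : L) else 0) (IsCMField.complexConj_ne_one L) w hw ta : ↥(unitaryGroupOfForm (galAdicCompletionMap (L := L) (IsCMField.complexConj L) hw) (placeForm (Matrix.of fun i j : Fin 3 => if i.val + j.val + 1 = 3 then (1 : L) else 0) w.1))) : GL (Fin 3) (w.1.adicCompletion L)) : Matrix (Fin 3) (Fin 3) (w.1.adicCompletion L)) - 1) M ∧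
                  LatticeInLevel ϖ b (((((localNonsplitEquiv (IsCMField.complexConj L) (Matrix.of fun i j : Fin 3 => if i.val + j.val + 1 = 3 then (1 : L) else 0) (IsCMField.complexConj_ne_one L) w hw ta : ↥(unitaryGroupOfForm (galAdicCompletionMap (L := L) (IsCMField.complexConj L) hw) (placeForm (Matrix.of fun i j : Fin 3 => if i.val + j.val + 1 = 3 then (1 : L) else 0) w.1))) : GL (Fin 3) (w.1.adicCompletion L)) : Matrix (Fin 3) (Fin 3) (w.1.adicCompletion L)) - 1) *
                    ((((localNonsplitEquiv (IsCMField.complexConj L) (Matrix.of fun i j : Fin 3 => if i.val + j.val + 1 = 3 then (1 : L) else 0) (IsCMField.complexConj_ne_one L) w hw ta : ↥(unitaryGroupOfForm (galAdicCompletionMap (L := L) (IsCMField.complexConj L) hw) (placeForm (Matrix.of fun i j : Fin 3 => if i.val + j.val + 1 = 3 then (1 : L) else 0) w.1))) : GL (Fin 3) (w.1.adicCompletion L)) : Matrix (Fin 3) (Fin 3) (w.1.adicCompletion L)) - 1)) M)}.ncard : ℕ) : ℤ)) =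
              (Literature.NumberTheory.QuadraticForms.hilbertSymbol (v.adicCompletion ↥(maximalRealSubfield L)) (β : (v.adicCompletion ↥(maximalRealSubfield L))) (algebraMap ↥(maximalRealSubfield L) _ ((cmQuadraticGenerator L : 𝓞 ↥(maximalRealSubfield L)) : ↥(maximalRealSubfield L))) : ℤ) * ((Fintype.card (Valued.ResidueField (w.1.adicCompletion L))) : ℤ) ^ m *
                ((((Fintype.card (Valued.ResidueField (w.1.adicCompletion L))) : ℤ) - 1) * (((Nat.card (MulAction.fixedBy (((UnitaryGroup.cmDatum L 2 (Matrix.of fun i j : Fin 2 => if i.val + j.val + 1 = 2 then (1 : L) else 0)).Local v) ⧸ cmLocalIntegralLevel L 2 (Matrix.of fun i j : Fin 2 => if i.val + j.val + 1 = 2 then (1 : L) else 0) v) γH.1)) + d % 2 : ℕ) : ℤ) + 2 - 2 * ((Fintype.card (Valued.ResidueField (w.1.adicCompletion L))) : ℤ) ^ T)) := by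
  classical
  have hc1 : IsCMField.complexConj L ≠ 1 := IsCMField.complexConj_ne_one L
  have hϖ0 : ϖ ≠ 0 := fun h0 => by rw [h0, map_zero] at hϖ; exact WithZero.zero_ne_coe hϖ
  have h20 : (2 : w.1.adicCompletion L) ≠ 0 := two_ne_zero_adicCompletion L v w
  have hc20 : (2 : w.1.adicCompletion L) * ϖ ≠ 0 := mul_ne_zero h20 hϖ0
  have hϖb0 : ϖ ^ (2 * b) ≠ 0 := pow_ne_zero _ hϖ0
  obtain ⟨V, hV, hVall⟩ := ((((eventually_nhds_one_le_tokenDepth L v w (6 * d + 3 * tE + a + b + 2)).and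
    (F0P3cDyRamRowOneRootDepth.eventually_nhds_one_valued_trace_sub_two_le L v w hc20)).and
    ((F0P3cDyRamRowOneRootDepth.eventually_nhds_one_valued_trace_sub_two_le L v w hϖb0).and
    (eventually_nhds_one_valued_sub_one_le L v w hϖb0)))).exists_mem
  refine ⟨V, hV, fun γH hγ hreg hirr E' _ _ _ _ c₁ δ m₀ s w₁ hw₁ Θ α lam hc₁1 hc₁δ hδ0 hmδ hs hΔ hDσ htσ hirr'
    hρρ hvρ hρj hjle1 hjfix hΘj hΘΘ hΘρ hvΘ hρα hα1 hint h2lam hlam2 hρlam hΘlam hvlam huniq hα hram => ?_⟩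
  intro th ta P₁ dg η γ₁ hth hta hform hdg1 hdgσ hησ hη1 hηN hγ₁U hγ₁χ φ h φ' h' hφc hφi hφs hφγ hφH hΘh hh hhyper
    hφ'c hφ'i hφ's hφ'γ hφ'H hΘh' hh' hjpow hfixpow hsmall J R R' f f' hfinV hRV hfinS hRS hJ hfinLS hfinLS' hu1 hf hf'
  haveI : Finite 𝓀[w₁.1.adicCompletion E'] := finite_residueField_adicCompletion E' w₁.1
  obtain ⟨hσres, hΘres, hΘne, hDΘ, hjv1, hqM⟩ :=
    ramK_frame_at_place' L w hw E' c₁ w₁ hw₁ hc₁1 he hD Θ hρρ hvρ hjle1 hjfix hΘj hΘΘ hvΘ hα1 hα hram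
  refine ⟨forall_fixed_fixed_exists_mul_theta_eq_of_frame hρρ hvρ hΘρ hα1 hα hDΘ hqM hσres hram, ?_⟩
  intro m β hmtok hβ
  obtain ⟨⟨hVm, hVtr⟩, hVtr2, hVu1, hVdet⟩ := hVall γH hγ
  have hm0' : 6 * d + 3 * tE + a + b + 2 ≤ m := hVm m hmtok
  have hm0 : 3 * d + 3 * tE + 2 ≤ m := by omega
  set ρ' : (w₁.1.adicCompletion E') →+* (w₁.1.adicCompletion E') := galAdicCompletionMap (L := E') c₁ hw₁ with hρ'def
  set ιw : (w.1.adicCompletion L) →+* (w₁.1.adicCompletion E') := toPlace w.1 w₁ with hιwdef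
  set u₀ : (w.1.adicCompletion L) := (((localNonsplitEquiv (IsCMField.complexConj L) (Matrix.of fun i j : Fin 1 => if i.val + j.val + 1 = 1 then (1 : L) else 0) (IsCMField.complexConj_ne_one L) w hw γH.2).val : GL (Fin 1) (w.1.adicCompletion L)) : Matrix (Fin 1) (Fin 1) (w.1.adicCompletion L)) 0 0 with hu₀def
  set qw : ℕ := Nat.card 𝓀[w.1.adicCompletion L] with hqwdef
  have hqw : qw = Fintype.card (Valued.ResidueField (w.1.adicCompletion L)) := Nat.card_eq_fintype_card
  have hϖE : Valued.v (ιw ϖ) = WithZero.exp (-1 : ℤ) := by rw [hjv1, hϖ]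
  have hϖE0 : ιw ϖ ≠ 0 := fun h0 => by rw [h0, map_zero] at hϖE; exact WithZero.zero_ne_coe hϖE
  have hϖE1 : Valued.v (ιw ϖ) < 1 := by rw [hϖE, ← WithZero.exp_zero, WithZero.exp_lt_exp]; norm_num
  have hρϖ : ρ' (ιw ϖ) = ιw ϖ := hρj ϖ
  have hqM2 : Nat.card 𝓀[w₁.1.adicCompletion E'] = qw ^ 2 := hqM
  have hΦ1 : IsUnit ((placeForm (Matrix.of fun i j : Fin 1 => if i.val + j.val + 1 = 1 then (1 : L) else 0) w.1) 0 0) := by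
    rw [placeForm_antidiagOne]
    simp [StdForm.over, StdForm.antidiagonal]
  have hu₀1 : (galAdicCompletionMap (L := L) (IsCMField.complexConj L) hw) u₀ * u₀ = 1 :=
    mul_map_eq_one_of_mem_unitary_one (galAdicCompletionMap (L := L) (IsCMField.complexConj L) hw) hΦ1 (localNonsplitEquiv (IsCMField.complexConj L) (Matrix.of fun i j : Fin 1 => if i.val + j.val + 1 = 1 then (1 : L) else 0) (IsCMField.complexConj_ne_one L) w hw γH.2).2
  obtain ⟨hu, hu1'⟩ := map_fixed_and_mul_map_eq_one (galAdicCompletionMap (L := L) (IsCMField.complexConj L) hw) ιw hΘj hjfix hu₀1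
  obtain ⟨jl, hjlv⟩ : ∃ jl : ℕ, Valued.v (lam - ρ' lam) = WithZero.exp (-(jl : ℤ)) := by
    have h0 : lam - ρ' lam ≠ 0 := by
      have hδM : ((δ : E') : w₁.1.adicCompletion E') ≠ 0 := by
        refine (Valuation.ne_zero_iff (Valued.v)).1 ?_
        rw [IsDedekindDomain.HeightOneSpectrum.valuedAdicCompletion_eq_valuation']
        exact (Valuation.ne_zero_iff _).2 hδ0
      have heq : lam - ρ' lam = ιw s * ((δ : E') : w₁.1.adicCompletion E') := by rw [hρlam]; linear_combination h2lam
      rw [heq]; exact mul_ne_zero ((map_ne_zero ιw).2 hs) hδM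
    have h1 : Valued.v (lam - ρ' lam) ≤ 1 := (Valuation.map_sub _ _ _).trans (max_le hvlam.le (by rw [hvρ]; exact hvlam.le))
    have hv0 : Valued.v (lam - ρ' lam) ≠ 0 := (Valuation.ne_zero_iff _).2 h0
    obtain ⟨k, hk⟩ : ∃ k : ℤ, Valued.v (lam - ρ' lam) = WithZero.exp k := ⟨_, (WithZero.exp_log hv0).symm⟩
    have hk0 : k ≤ 0 := by rw [hk, ← WithZero.exp_zero, WithZero.exp_le_exp] at h1; exact h1
    exact ⟨(-k).toNat, by rw [hk, Int.toNat_of_nonneg (by omega), neg_neg]⟩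
  have hjl : Valued.v ((lam - ιw u₀) - ρ' (lam - ιw u₀)) = WithZero.exp (-(jl : ℤ)) := by
    rw [ρ'.map_sub, hu, sub_sub_sub_cancel_right, hjlv]
  have hm : Valued.v (lam - ιw u₀) = WithZero.exp (-(m : ℤ)) := by
    have hu₀γ : u₀ = finGammaTwo L v γH w := rfl
    have hNρ : ιw (((finCharpolyTwo L v γH).eval (finGammaTwo L v γH)) w) = (lam - ιw u₀) * ρ' (lam - ιw u₀) := by
      rw [eval_finCharpolyTwo_finGammaTwo_apply_eq_quadratic L v w γH, ← hu₀γ, map_add, map_sub, map_pow, map_mul, ρ'.map_sub, hu, hρlam]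
      linear_combination hlam2
    have hv2 : Valued.v ((lam - ιw u₀) * ρ' (lam - ιw u₀)) = WithZero.exp (-(2 * (m : ℤ))) := by
      rw [← hNρ, hjv1, hmtok, map_pow, (valued_toPlace_uniformizer_of_ramified L (IsCMField.complexConj L) hc1 w hw he).1, ← WithZero.exp_nsmul, nsmul_eq_mul]
      congr 1; ring
    exact v_eq_exp_neg_of_v_mul_map_eq hvρ hv2
  have hiff : ∀ j, IsOrd ρ' α (ιw ϖ ^ j) lam ↔ j ≤ jl := fun j =>
    isOrd_pow_iff_le hρα hϖE0 hϖE1 hvlam.le (by rw [hjlv, hα, mul_one, hϖE, ← WithZero.exp_nsmul, nsmul_eq_mul, mul_neg, mul_one]) j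
  have hJle : jl ≤ J := by
    have h := hJ; rw [hiff] at h; omega
  have hFN' := forall_fixed_fixed_exists_mul_theta_eq_of_frame hρρ hvρ hΘρ hα1 hα hDΘ hqM hσres hram
  have hRcells := F0P3cDyRamOrderCountCellsBound.hRcells_h L w hw hϖ hD h2v ιw hρρ hvρ hjle1 hjfix hΘj hΘΘ hΘρ hvΘ hρα hα1 hint hvlam hth φ
    hφc hφi hφs hφγ hφH hΘh hh hjpow hsmall hRV hu1 hFN'
  have hRcells' := F0P3cDyRamOrderCountCellsBound.hRcells_h' L w hw hϖ hD h2v ιw hρρ hvρ hjle1 hjfix hΘj hΘΘ hΘρ hvΘ hρα hα1 hint hvlam hta hform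
    hdg1 hdgσ hησ hη1 φ' hφ'c hφ'i hφ's hφ'γ hφ'H hΘh' hh' hjpow hsmall hRS hu1 hFN'
  obtain ⟨hd2, hjlS, hmpar, hmS⟩ := btop_tokens_cm L w hw ϖ d tE hD h2v ιw hjv1 ρ' Θ hρρ hvρ hΘρ hjfix hΘj hDΘ hα1 hα hram
    hΘlam hlam2 hρlam hirr' hDσ hu₀1 hm hjl (by omega)
  set ε : ℤ := hilbertSymbol (v.adicCompletion ↥(maximalRealSubfield L)) (β : (v.adicCompletion ↥(maximalRealSubfield L))) (algebraMap ↥(maximalRealSubfield L) _ ((cmQuadraticGenerator L : 𝓞 ↥(maximalRealSubfield L)) : ↥(maximalRealSubfield L))) with hεdef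
  have hε : ε = 1 ∨ ε = -1 := hilbertSymbol_eq_one_or_eq_neg_one _ _
  have hεQ : (ε : ℚ) = 1 ∨ (ε : ℚ) = -1 := by rcases hε with h | h <;> simp [h]
  have hχ : ((finCharpolyTwo L v γH).eval (finGammaTwo L v γH)) w = u₀ ^ 2 - (((γH.1.val : GL (Fin 2) (UnitaryGroup.LocalRing L v)).val.map (Pi.evalRingHom (fun w' : UnitaryGroup.PlacesOver L v => w'.1.adicCompletion L) w))).trace * u₀ + (((γH.1.val : GL (Fin 2) (UnitaryGroup.LocalRing L v)).val.map (Pi.evalRingHom (fun w' : UnitaryGroup.PlacesOver L v => w'.1.adicCompletion L) w))).det :=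
    eval_finCharpolyTwo_finGammaTwo_apply_eq_quadratic L v w γH
  have hside := btop_side_symbol_cm L w hw ϖ d tE hD h2v ιw hjv1 ρ' Θ hρρ hvρ hΘρ hjfix hΘj hDΘ hα1 hα hram hΘh hh hhyper
    hΘlam hlam2 hρlam hirr' hDσ hu₀1 (jl := jl) hm (by omega) (β : v.adicCompletion ↥(maximalRealSubfield L)) hχ hβ
  have hplane : ¬ ∃ x : Fin 2 → (w.1.adicCompletion L), x ≠ 0 ∧ pairing (galAdicCompletionMap (L := L) (IsCMField.complexConj L) hw) (Matrix.diagonal dg) x x = 0 :=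
    not_exists_pairing_diagonal_self_eq_zero_of_formCongr (galAdicCompletionMap (L := L) (IsCMField.complexConj L) hw) P₁ dg η (by rw [← placeForm_antidiagOne]; exact hform) hdgσ (fun i h0 => by have h1 := hdg1 i; rw [h0, map_zero] at h1; exact zero_ne_one h1) hηN
  have haniso : ¬ ∃ z : (w₁.1.adicCompletion E'), z ≠ 0 ∧ h' * Θ z * z + ρ' (h' * Θ z * z) = 0 :=
    not_exists_herm_self_eq_zero_of_lineModel (galAdicCompletionMap (L := L) (IsCMField.complexConj L) hw) (Matrix.diagonal dg) ιw φ' hφ's hφ'H hplane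
  have hlamΘ : lam * Θ lam = 1 := by rw [mul_comm]; exact hΘlam
  have h2w : Valued.v (2 : w.1.adicCompletion L) = Valued.v ϖ ^ tE := hD.2.2.2.2.2.2
  have hϖ1 : Valued.v ϖ < 1 := by rw [hϖ, ← WithZero.exp_zero, WithZero.exp_lt_exp]; norm_num
  have htr2 : Valued.v ((((γH.1.val : GL (Fin 2) (UnitaryGroup.LocalRing L v)).val.map (Pi.evalRingHom (fun w' : UnitaryGroup.PlacesOver L v => w'.1.adicCompletion L) w))).trace - 2) < Valued.v (2 : w.1.adicCompletion L) := by
    refine hVtr.trans_lt ?_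
    rw [map_mul]
    exact mul_lt_of_lt_one_right ((Valuation.pos_iff _).2 h20) hϖ1
  have htrv := valued_trace_eq_of_sub_two_lt htr2
  have hsq := sq_sub_map_eq_map_disc ιw hρlam hlam2
  have hmjl : m ≤ jl := by
    have hle : Valued.v ((lam - ιw u₀) - ρ' (lam - ιw u₀)) ≤ Valued.v (lam - ιw u₀) := (Valuation.map_sub _ _ _).trans (max_le le_rfl (by rw [hvρ]))
    rw [hjl, hm, WithZero.exp_le_exp] at hle; omega
  have hΔv : Valued.v ((((γH.1.val : GL (Fin 2) (UnitaryGroup.LocalRing L v)).val.map (Pi.evalRingHom (fun w' : UnitaryGroup.PlacesOver L v => w'.1.adicCompletion L) w))).trace ^ 2 - 4 * (((γH.1.val : GL (Fin 2) (UnitaryGroup.LocalRing L v)).val.map (Pi.evalRingHom (fun w' : UnitaryGroup.PlacesOver L v => w'.1.adicCompletion L) w))).det) = WithZero.exp (-(2 * (jl : ℤ))) := by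
    rw [← hjv1, ← hsq, map_pow, hjlv, ← WithZero.exp_nsmul, nsmul_eq_mul]; congr 1; ring
  have htube : Valued.v ((((γH.1.val : GL (Fin 2) (UnitaryGroup.LocalRing L v)).val.map (Pi.evalRingHom (fun w' : UnitaryGroup.PlacesOver L v => w'.1.adicCompletion L) w))).trace ^ 2 - 4 * (((γH.1.val : GL (Fin 2) (UnitaryGroup.LocalRing L v)).val.map (Pi.evalRingHom (fun w' : UnitaryGroup.PlacesOver L v => w'.1.adicCompletion L) w))).det) <
      Valued.v (4 : w.1.adicCompletion L) * Valued.v ϖ ^ 2 * Valued.v ((((γH.1.val : GL (Fin 2) (UnitaryGroup.LocalRing L v)).val.map (Pi.evalRingHom (fun w' : UnitaryGroup.PlacesOver L v => w'.1.adicCompletion L) w))).trace) ^ 2 := by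
    rw [hΔv, htrv, show (4 : w.1.adicCompletion L) = 2 ^ 2 by norm_num, map_pow, h2w, hϖ, ← pow_mul, ← pow_add, ← pow_add, ← WithZero.exp_nsmul, nsmul_eq_mul, mul_neg, mul_one, WithZero.exp_lt_exp]
    push_cast; omega
  haveI : Finite (IsLocalRing.ResidueField 𝒪[v.adicCompletion ↥(maximalRealSubfield L)]) :=
    finite_residueField_adicCompletion ↥(maximalRealSubfield L) v
  obtain ⟨αH, sH, g, uτ, wτ, z, n, dK, hαH, hvαH, hsH, hdesc, hz, hdisc, huτ, hdat, hdK, hlev⟩ :=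
    hSide_closedForm_of_tube_exists L v w hw (HeckeCharacter.valued_uniformizer v) he hD γH.1 hirr htube
  have hσι : ∀ y, (galAdicCompletionMap (L := L) (IsCMField.complexConj L) hw) (toPlace v w y) = toPlace v w y :=
    fun y => galAdicCompletionMap_toPlace (IsCMField.complexConj L) w w hw y
  have hι2 : ∀ y, Valued.v (toPlace v w y) = Valued.v y ^ 2 :=
    fun y => valued_toPlace_eq_pow_two_of_ramified (IsCMField.complexConj L) w (IsCMField.complexConj_ne_one L) hw he y
  have hαH0 : αH ≠ 0 := fun h0 => by
    rw [h0, map_zero] at hvαH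
    rcases hvαH with h1 | h1
    · exact zero_ne_one h1
    · exact WithZero.zero_ne_coe h1
  have ht0 : (((γH.1.val : GL (Fin 2) (UnitaryGroup.LocalRing L v)).val.map (Pi.evalRingHom (fun w' : UnitaryGroup.PlacesOver L v => w'.1.adicCompletion L) w))).trace ≠ 0 := fun h0 => by
    rw [h0, map_zero] at htrv; exact h20 ((map_eq_zero _).1 htrv.symm)
  obtain ⟨-, hwτ1, hH⟩ := hdat.resolve_left (fun hin =>
    F0P3cDyRamTypeBSelector.not_inertDatum_typeB_of_organ (toPlace v w) hι2 _ hσι ιw hjv1 ρ' Θ hjfix hΘj hΘres h20 hlam2 hρlam hΘlam hirr' ht0 rfl rfl hαH0 hsH hdesc hz hdisc huτ hin.1 hdK hin.2.2.1)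
  have hjl2n : jl = 2 * n + dK :=
    condLevel_eq_of_hlev ιw hjv1 hϖ hsq hjlv hlev htrv ((Valuation.ne_zero_iff _).2 h20)
  have hdKd : dK = d :=
    F0P3cDyRamTypeBSelector.discDepth_eq_typeB_of_organ (toPlace v w) hι2 _ hσι ιw hjv1 ρ' Θ hρρ hvρ hjfix hΘj hΘΘ hΘρ h20 hDΘ hlam2 hρlam hΘlam hDσ ht0 rfl rfl hαH0 hsH hdesc (Matrix.GeneralLinearGroup.det_ne_zero g) hz hdisc (HeckeCharacter.valued_uniformizer v) hwτ1 hdK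
  have hnjl : (jl - d) / 2 + 1 = n + 1 := by omega
  have hq1 : 1 ≤ qw := by rw [hqw]; exact Fintype.card_pos
  have hq2 : 2 ≤ qw := by have h1 : 1 < Nat.card 𝓀[w.1.adicCompletion L] := Finite.one_lt_card; rw [← hqwdef] at h1; omega
  have hx : (qw : ℚ) ≠ 1 := by exact_mod_cast (show qw ≠ 1 by omega)
  have hu₀γ : u₀ = finGammaTwo L v γH w := rfl
  have ham : a ≤ m := by omega
  have hbm : b ≤ m := by omega
  have hab : a ≤ b := by omega
  have hvϖ2b : Valued.v (ϖ ^ (2 * b)) = Valued.v ϖ ^ (2 * b) := map_pow _ _ _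
  have hu1le : Valued.v (u₀ - 1) ≤ Valued.v ϖ ^ (2 * b) := by rw [hu₀γ, ← hvϖ2b]; exact hVu1
  have hdetle := hVdet
  rw [hvϖ2b] at hdetle
  have htrle := hVtr2
  rw [hvϖ2b] at htrle
  obtain ⟨nν, hnνb, hnν, hm₁, hm₂, hjl', hlev, hlev2, hdeep, huc, huc2⟩ :=
    levelTokens_near_one ιw hvρ hjv1 hρj hϖ hρlam hlam2 hα hjlv hm hab ham hdetle htrle hu1le
  have hle12 : m - a ≤ m + nν - b := by omega
  have hajl : a ≤ jl := by omega
  have hρϖa : ρ' (ιw ϖ ^ a) = ιw ϖ ^ a := by rw [map_pow, hρϖ]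
  have htea : Valued.v (ιw ϖ ^ a) = WithZero.exp (-(a : ℤ)) := by
    rw [map_pow, hϖE, ← WithZero.exp_nsmul, nsmul_eq_mul, mul_neg, mul_one]
  have hΓ := (localNonsplitEquiv (IsCMField.complexConj L) (Matrix.of fun i j : Fin 3 => if i.val + j.val + 1 = 3 then (1 : L) else 0)
    (IsCMField.complexConj_ne_one L) w hw th).2
  rw [hth] at hΓ
  have hmem := (localNonsplitEquiv (IsCMField.complexConj L) (Matrix.of fun i j : Fin 3 => if i.val + j.val + 1 = 3 then (1 : L) else 0)
    (IsCMField.complexConj_ne_one L) w hw ta).2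
  rw [hta] at hmem
  have hσ : ∀ x, (galAdicCompletionMap (L := L) (IsCMField.complexConj L) hw) ((galAdicCompletionMap (L := L) (IsCMField.complexConj L) hw) x) = x :=
    galAdicCompletionMap_involutive L v w hw
  have hvσ : ∀ x, Valued.v ((galAdicCompletionMap (L := L) (IsCMField.complexConj L) hw) x) = Valued.v x :=
    fun x => valued_galAdicCompletionMap (L := L) (IsCMField.complexConj L) hw x
  have hH₂σ : ((placeForm (Matrix.of fun i j : Fin 2 => if i.val + j.val + 1 = 2 then (1 : L) else 0) w.1).map (galAdicCompletionMap (L := L) (IsCMField.complexConj L) hw))ᵀ = placeForm (Matrix.of fun i j : Fin 2 => if i.val + j.val + 1 = 2 then (1 : L) else 0) w.1 :=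
    placeForm_map_transpose_of_hermitian L v w hw _ (antidiagOne_isHermitian L 2)
  have hDgσ : ((Matrix.diagonal dg).map (galAdicCompletionMap (L := L) (IsCMField.complexConj L) hw))ᵀ = Matrix.diagonal dg := by
    rw [Matrix.diagonal_map (map_zero _), Matrix.diagonal_transpose]
    exact congrArg Matrix.diagonal (funext hdgσ)
  obtain ⟨z, ξ, hz1, hzξ, hσξ, hξN⟩ := exists_flipUnit_of_forall_fixed_fixed_isNorm (galAdicCompletionMap (L := L) (IsCMField.complexConj L) hw) hD ιw hvΘ hΘj hjfix hjpow hFN'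
  have hca0 : ϖ ^ a ≠ 0 := pow_ne_zero _ hϖ0
  have hca1 : Valued.v (ϖ ^ a) ≤ 1 := by rw [map_pow]; exact pow_le_one₀ zero_le hϖ1.le
  obtain ⟨C, hCdef⟩ : ∃ C : ℕ, C = m + jl - b := ⟨_, rfl⟩
  have hwP : ∀ b' ∈ Finset.Icc 1 R, ∀ j ∈ Finset.range (jl - a + 1), (if j + b' + nν ≤ (m + nν - b) + jl then ∑ᶠ Λ ∈ levelSetDep ρ' Θ α (ιw ϖ) h j b' ((ιw ϖ ^ a)⁻¹ * (lam - ιw u₀)), f b' j Λ else 0) = (if j + b' ≤ C then qw ^ b' * (levelSetDep ρ' Θ α (ιw ϖ) h j b' ((ιw ϖ ^ a)⁻¹ * (lam - ιw u₀))).ncard else 0) := by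
    intro b' hb' j hj
    rw [Finset.mem_range] at hj
    by_cases hc : j + b' ≤ C
    · rw [if_pos (by omega), if_pos hc]
      have hw := finsum_levelSetDep_weight_eq_pow_mul_ncard_inv_mul (galAdicCompletionMap (L := L) (IsCMField.complexConj L) hw) hσ hvσ hϖ hD h2v hH₂σ (hW := (1 : (w.1.adicCompletion L))) (by rw [map_one]) (map_one _) ιw hρρ hvρ hρα hα1 hint hΘΘ hΘρ hvΘ hΘj hjle1 hjfix hjpow hsmall φ hφc hφi hφs hφγ hvlam hΘh hh hφH z hz1 ξ hzξ hσξ hξN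
        u₀ hca0 hca1 (Finset.mem_Icc.1 hb').1 ((hiff j).2 (by omega)) (hfinLS j b') f hf
      rw [map_pow] at hw
      rw [hw, hqwdef]
    · rw [if_neg (by omega), if_neg hc]
  have hwM : ∀ b' ∈ Finset.Icc 1 R', ∀ j ∈ Finset.range (jl - a + 1), (if j + b' + nν ≤ (m + nν - b) + jl then ∑ᶠ Λ ∈ levelSetDep ρ' Θ α (ιw ϖ) h' j b' ((ιw ϖ ^ a)⁻¹ * (lam - ιw u₀)), f' b' j Λ else 0) = (if j + b' ≤ C then qw ^ b' * (levelSetDep ρ' Θ α (ιw ϖ) h' j b' ((ιw ϖ ^ a)⁻¹ * (lam - ιw u₀))).ncard else 0) := by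
    intro b' hb' j hj
    rw [Finset.mem_range] at hj
    by_cases hc : j + b' ≤ C
    · rw [if_pos (by omega), if_pos hc]
      have hw := finsum_levelSetDep_weight_eq_pow_mul_ncard_inv_mul (galAdicCompletionMap (L := L) (IsCMField.complexConj L) hw) hσ hvσ hϖ hD h2v hDgσ hη1 hησ ιw hρρ hvρ hρα hα1 hint hΘΘ hΘρ hvΘ hΘj hjle1 hjfix hjpow hsmall φ' hφ'c hφ'i hφ's hφ'γ hvlam hΘh' hh' hφ'H z hz1 ξ hzξ hσξ hξN u₀ hca0 hca1 (Finset.mem_Icc.1 hb').1 ((hiff j).2 (by omega)) (hfinLS' j b') f' hf'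
      rw [map_pow] at hw
      rw [hw, hqwdef]
    · rw [if_neg (by omega), if_neg hc]
  have hκ : ∀ j, IsOrd ρ' α (ιw ϖ ^ j) (ιw ϖ ^ a) := fun j =>
    isOrd_of_map_eq_self hρϖa (by rw [htea, ← WithZero.exp_zero, WithZero.exp_le_exp]; omega) _
  have hμfac : lam - ιw u₀ = ιw ϖ ^ a * ((ιw ϖ ^ a)⁻¹ * (lam - ιw u₀)) := by
    rw [mul_inv_cancel_left₀ (pow_ne_zero _ hϖE0)]
  have hRh : ∀ j b', 1 ≤ b' → j ≤ jl - a → (levelSetDep ρ' Θ α (ιw ϖ) h j b' ((ιw ϖ ^ a)⁻¹ * (lam - ιw u₀))).Nonempty → b' ≤ R :=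
    fun j b' hb' hj hne => hRcells j b' hb' ((hiff j).2 (by omega)) (hne.mono (levelSetDep_subset_of_eq_mul hvρ (hκ j) hμfac))
  have hRh' : ∀ j b', 1 ≤ b' → j ≤ jl - a → (levelSetDep ρ' Θ α (ιw ϖ) h' j b' ((ιw ϖ ^ a)⁻¹ * (lam - ιw u₀))).Nonempty → b' ≤ R' :=
    fun j b' hb' hj hne => hRcells' j b' hb' ((hiff j).2 (by omega)) (hne.mono (levelSetDep_subset_of_eq_mul hvρ (hκ j) hμfac))
  obtain ⟨-, -, -, hκΘ, -⟩ := token_kappa hρρ hvρ hΘρ hvΘ hlamΘ hu hu1' hm hjl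
  have hjlpar : jl % 2 = d % 2 := mod_two_eq_of_v_sub_map_eq hΘΘ hϖE hDΘ.2.2.2.2.1 hDΘ.2.2.2.1 hκΘ
  have hme : m - a + a = m := by omega
  have hjle : jl - a + a = jl := by omega
  have hjlS0 : 3 * d ≤ jl - a + 2 + 2 * (d % 2) := by omega
  have hmS0 : d - d % 2 ≤ m - a + 1 := by omega
  have hjlS1 : 3 * d ≤ jl - a + 3 := by omega
  have hmS1 : d ≤ m - a + 1 := by omega
  have hm1jl1 : m - a ≤ jl - a := by omega
  have hC1 : jl - a ≤ C := by rw [hCdef]; omega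
  have hCe : C + d ≤ m - a + (jl - a) + 1 := by rw [hCdef]; omega
  have hfar : m - a + 2 * d ≤ C + 2 := by rw [hCdef]; omega
  have hq1F : 1 ≤ Fintype.card (Valued.ResidueField (w.1.adicCompletion L)) := Fintype.card_pos
  have hxF : ((Fintype.card (Valued.ResidueField (w.1.adicCompletion L)) : ℕ) : ℚ) ≠ 1 := by
    rw [← hqw]; exact_mod_cast (show qw ≠ 1 by omega)
  have hcntP := ncard_typeZero_fixed_endoGL_levels_eq_cutoff_unr L w hw hϖ ιw hρρ hvρ hρα hα1 hint hΘΘ hΘρ hvΘ hΘj hjle1 hjfix hjpow hfixpow hsmall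
    φ hφc hφi hφs _ hφγ hvlam hΘh hh hφH _ hΓ hu1 a b huc huc2 hfinV hRV hJ hfinLS f hf hα hϖE hm₁ hm₂ hle12 hjl' hlev hajl hlev2 hdeep hnν
  have hcntM := ncard_typeZero_fixed_conj_endoGL_levels_eq_cutoff_unr L w hw hϖ ιw hρρ hvρ hρα hα1 hint hΘΘ hΘρ hvΘ hΘj hjle1 hjfix hjpow hfixpow hsmall
    P₁ dg η γ₁ _ hform hdg1 hdgσ hησ hη1 hmem hu1 a b huc huc2 φ' hφ'c hφ'i hφ's hφ'γ hvlam hΘh' hh' hφ'H hfinS hRS hJ hfinLS' f' hf'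
    hα hϖE hm₁ hm₂ hle12 hjl' hlev hajl hlev2 hdeep hnν
  rw [Finset.sum_congr rfl fun b' hb' => Finset.sum_congr rfl fun j hj => hwP b' hb' j hj] at hcntP
  rw [Finset.sum_congr rfl fun b' hb' => Finset.sum_congr rfl fun j hj => hwM b' hb' j hj] at hcntM
  rw [hth, hta, hcntP, hcntM, hqw]
  clear hcntP hcntM hwP hwM
  rcases Nat.mod_two_eq_zero_or_one a with ha2 | ha2
  · -- standard parity lane (`a` even)
    have hweld := levelOrderCounts_ramK_weld_cut hρρ hvρ hΘρ hα1 hα hDΘ hρϖ hqM2 hσres hram hΘh hh hhyper hΘh' hh' haniso hlamΘ hu hu1' hm hjl hd2 hmpar hρϖa htea ha2 had hme hjle hjlS0 hmS0 (ε : ℚ) hεQ hside C hC1 hCe hRh hRh'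
    rw [hqw] at hweld
    refine levels_bottom_arith hε hweld ?_ hH hq1F
    rw [filter_band_eq_Ioc hd2 hm1jl1 hC1 hfar, sum_pow_add_eq_mul_sum, ← mul_assoc (2 : ℚ)]
    obtain ⟨eLU, e1, e2, e3⟩ := exponents_std hjlpar hmpar hmjl hab1 hbm hd2 hCdef hnjl ha2 hks hT0 (by omega)
    exact law_arith _ hxF eLU e1 e2 e3
  · -- flipped parity lane (`a` odd)
    have hweld := levelOrderCounts_ramK_weld_cut_flip hρρ hvρ hΘρ hα1 hα hDΘ hρϖ hqM2 hσres hram hΘh hh hhyper hΘh' hh' haniso hlamΘ hu hu1' hm hjl hd2 hmpar hρϖa htea ha2 had hme hjle hjlS1 hmS1 (ε : ℚ) hεQ hside C hC1 hCe hRh hRh'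
    rw [hqw] at hweld
    refine levels_bottom_arith hε hweld ?_ hH hq1F
    rw [filter_band_eq_Ioc hd2 hm1jl1 hC1 hfar, sum_pow_add_eq_mul_sum, ← mul_assoc (2 : ℚ)]
    obtain ⟨eLU, e1, e2, e3⟩ := exponents_flip hjlpar hmpar hmjl hab1 hbm hd2 hCdef hnjl ha2 hks hT1 (by omega)
    exact law_arith _ hxF eLU e1 e2 e3


end Summit.HodgeConjecture.HodgeConjecture.Cruxes.H413.F0P3cDyRamLevelsCensusRamK

end
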